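import Literature.NumberTheory.Automorphic.UnitaryGroupHeisenbergKAverageArchSmooth
import Literature.NumberTheory.Automorphic.UnitaryGroupSingularHeisenbergFibreIntegral
import Literature.NumberTheory.Automorphic.UnitaryGroupTraceZeroLine
import Literature.NumberTheory.Automorphic.AdicCompletionCompact
import Literature.NumberTheory.Automorphic.UnitaryGroupSingularHeisenbergFibre
import Literature.NumberTheory.Automorphic.UnitaryGroupCuspConditionBorel
import HarnessLib

/-!
# The singular line function of `U(J₃)` is smooth in the archimedean variable:
# `t_∞ ↦ ∫_{𝔸_E} ∫_K f(k⁻¹ (u(x)⁻¹ (γ₀ n(θ(t_∞, y))) u(x)) k) dμK dμX` is `C^∞` on `F_∞`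
(Rogawski, *Automorphic Representations of Unitary Groups in Three Variables* (1990), §7.2, proof of Prop. 7.2.2, pp. 94–95: the
function `ψ(w) = ∫_{𝔸_E} f^K(u(x)⁻¹ γ n(w) u(x)) dx` on the centre line `w = t δ₀`, `t ∈ 𝔸_F`; Hörmander, Thm. 1.1.9)

Topic `NumberTheory/Automorphic`; namespace `Literature.NumberTheory.Automorphic.UnitaryGroup`. THEOREMS ONLY over accepted tree modules
(no definition, no named fact, no instance, no notation, no `sorry`). FILE 1 of the row (L5-iii-c) binder (hSB⁻) of the LAW 5 road of
`Cruxes/H413/Lines/F0_T1InnerFormTraceIdentity.lean` (cell `pub/hodgecm-mathlib`, crux H413): the SINGULAR twin of ★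
`UnitaryGroupHeisenbergKAverageArchSmooth`; FILE 2 (`UnitaryGroupSingularLineSchwartzBruhat`) concludes `ψ^K ∘ θ ∈ 𝒮(𝔸_F)`.

Letters (★ `UnitaryGroupSingularHeisenbergFibreIntegral`, A-p14): `G = U(J₃)` quasi-split (`hc : c * c = 1`), `π = adelicVal`, `u(x) = heisElt hc x 0`,
`n(w) = heisElt hc 0 w`, the singular base point `γ₀ = ι(d(a, b, a))`, `a ≠ b` (`hg₀`, `hγ₀`, `hab`), the centre line
`θ = traceZeroLine F E c hcδ hδ : 𝔸_F ≃ₜ+ 𝔸_E⁻` (★ `UnitaryGroupTraceZeroLine`), a compact subgroup `K ≤ G(𝔸_F)` with a finite Borel measure `μK`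
(the `K`-average INSIDE), a Haar measure `μX` on `𝔸_E`, and a test function `f` (★ `IsQuasiSplitTest`, `f = η ∘ π`).
* §1 `coe_toMixed_adelicVal_heisChart_zero` (`π(n(w))_∞ = 1 + w_∞ E₀₂`); the TUBE LEMMA ALONG THE CENTRE LINE
  `exists_levelIdeal_forall_conj_center_traceZeroLine_mem`; `exists_isCompact_singularKernel_conj_support` (uniform compact supports in `x`, `w`).
* §2 **`contDiff_singularLine_kAverage`** (and `…_of_isSmoothKernelGL`) — `t_∞ ↦ ∫_{𝔸_E} ∫_K f(k⁻¹ (u(x)⁻¹ (γ₀ n(θ(t_∞, y))) u(x)) k) dμK dμX` is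
  `C^∞` on `F_∞`: Fubini to `μX ⊗ μK` and ★ `IsSmoothKernelGL.contDiff_integral_of_toMixed_eq` (Hörmander 1.1.9) — the archimedean part of the
  argument is `π(k⁻¹)_∞ (π(u(x)⁻¹)_∞ (π(γ₀)_∞ (1 + (θ t)_∞ E₀₂)) π(u(x))_∞) π(k)_∞`, real-affine in `t_∞` (`θ` additive and continuous).

## References
* J. D. Rogawski, *Automorphic Representations of Unitary Groups in Three Variables*, Ann. of Math. Stud. 123 (1990), §7.2, §1.10 [Rogawski1990].
* A. Weil, *Basic Number Theory*, Grundlehren 144 (1967), Ch. VII §2 [WeilBNT1967].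
* L. Hörmander, *The Analysis of Linear Partial Differential Operators I*, Grundlehren 256 (1983), Thm. 1.1.9 [HormanderALPDO1].
-/

set_option autoImplicit false

noncomputable section

open MeasureTheory NumberField NumberField.mixedEmbedding IsDedekindDomain Set Topology Filter Function
-- `Classical` is needed to see the Mathlib normed-space instances on `mixedSpace E` (note H5 of `AdelicGLnGlue`)
open scoped ContDiff Classical MatrixGroups Matrix

namespace Literature.NumberTheory.Automorphic

namespace UnitaryGroup
-- the Banach algebra structure of `M_n(K_∞)` through which `IsArchSmooth` is defined
open scoped Matrix.Norms.Operator

variable {F E : Type} [Field F] [NumberField F] [Field E] [NumberField E] [Algebra F E] {c : E ≃ₐ[F] E}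

/-! ## §1 Centre-line plumbing: archimedean part, tube lemma, uniform compact supports -/

section Plumbing
/-- **`π(n(w))_∞ = 1 + w_∞ E₀₂`**: the archimedean part of a centre element of the Heisenberg group (★ `coe_toMixed_adelicVal` at
`x = 0`). [cite: Rogawski1990, §1.10] -/
theorem coe_toMixed_adelicVal_heisChart_zero (hc : c * c = 1) (w : traceZeroAdele F E c) :
    ((GLn.toMixed 3 E (adelicVal F E c 3 _ (heisChart hc ((0 : AdeleRing (𝓞 E) E), w) : (quasiSplit F E c 3).Adelic)) :
        GL (Fin 3) (mixedSpace E)) : Matrix (Fin 3) (Fin 3) (mixedSpace E)) =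
      1 + Matrix.single 0 2 (archHom E (w : AdeleRing (𝓞 E) E)) := by
  simp only [coe_toMixed_adelicVal hc, coordX_heisChart, coordY_heisChart, heisZ, map_zero, neg_zero, mul_zero, sub_zero,
    Matrix.single_zero, add_zero]

variable [Algebra.IsQuadraticExtension F E] {δ : E}

/-- **THE TUBE LEMMA ALONG THE CENTRE LINE**: for an open `U ∋ 1` of `G(𝔸_F)` and a compact `K ⊆ G(𝔸_F)` there is an ideal `𝔫 ≠ 0`
of `𝓞_F` with `k⁻¹ · n(θ(0, δ′)) · k ∈ U` for every `δ′ ∈ 𝔫𝒪̂_F` and every `k ∈ K` (`(k, δ′) ↦ k⁻¹ n(θ(0,δ′)) k` is continuous and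
`= 1` at `δ′ = 0`; Mathlib `generalized_tube_lemma`; the ideal boxes are cofinal at `0`, ★
`FiniteAdeleRing.exists_forall_valued_le_idealRadius_imp_mem`). [cite: WeilBNT1967, Ch. VII §2] [cite: Rogawski1990, §7.2 (pp. 94–95)] -/
theorem exists_levelIdeal_forall_conj_center_traceZeroLine_mem (hc : c * c = 1) (hcδ : c δ = -δ) (hδ : δ ≠ 0)
    {K : Set (quasiSplit F E c 3).Adelic} (hK : IsCompact K) {U : Set (quasiSplit F E c 3).Adelic} (hUo : IsOpen U)
    (hU1 : (1 : (quasiSplit F E c 3).Adelic) ∈ U) :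
    ∃ 𝔫 : Ideal (𝓞 F), 𝔫 ≠ 0 ∧ ∀ δ' ∈ levelIdeal F 𝔫, ∀ k ∈ K,
      k⁻¹ * (heisChart hc ((0 : AdeleRing (𝓞 E) E),
        traceZeroLine F E c hcδ hδ ((((0 : InfiniteAdeleRing F), δ') : AdeleRing (𝓞 F) F))) : (quasiSplit F E c 3).Adelic) * k ∈ U := by
  set Θ : (quasiSplit F E c 3).Adelic × FiniteAdeleRing (𝓞 F) F → (quasiSplit F E c 3).Adelic := fun p =>
    p.1⁻¹ * (heisChart hc ((0 : AdeleRing (𝓞 E) E),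
      traceZeroLine F E c hcδ hδ ((((0 : InfiniteAdeleRing F), p.2) : AdeleRing (𝓞 F) F))) : (quasiSplit F E c 3).Adelic) * p.1
    with hΘ
  have hδc : Continuous fun δ' : FiniteAdeleRing (𝓞 F) F => ((((0 : InfiniteAdeleRing F), δ') : AdeleRing (𝓞 F) F)) :=
    continuous_const.prodMk continuous_id
  have hΘc : Continuous Θ := by
    refine (continuous_fst.inv.mul ?_).mul continuous_fst
    exact continuous_subtype_val.comp ((heisChart hc).continuous.comp (continuous_const.prodMk
      ((traceZeroLine F E c hcδ hδ).continuous.comp (hδc.comp continuous_snd))))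
  have hsub : K ×ˢ ({0} : Set (FiniteAdeleRing (𝓞 F) F)) ⊆ Θ ⁻¹' U := by
    rintro ⟨k, δ'⟩ ⟨-, hδ0⟩
    rw [mem_singleton_iff] at hδ0
    subst hδ0
    have hθ0 : traceZeroLine F E c hcδ hδ ((((0 : InfiniteAdeleRing F), (0 : FiniteAdeleRing (𝓞 F) F)) : AdeleRing (𝓞 F) F)) = 0 :=
      map_zero _
    have h1 : Θ (k, 0) = 1 := by
      show k⁻¹ * (heisChart hc ((0 : AdeleRing (𝓞 E) E),
        traceZeroLine F E c hcδ hδ ((((0 : InfiniteAdeleRing F), (0 : FiniteAdeleRing (𝓞 F) F)) : AdeleRing (𝓞 F) F))) :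
          (quasiSplit F E c 3).Adelic) * k = 1
      rw [hθ0, heisChart_zero hc, OneMemClass.coe_one, mul_one, inv_mul_cancel]
    show Θ (k, 0) ∈ U
    rw [h1]
    exact hU1
  obtain ⟨u', v, -, hvo, hKu', h0v, huv⟩ := generalized_tube_lemma hK isCompact_singleton (hUo.preimage hΘc) hsub
  have hv : v ∈ 𝓝 (0 : FiniteAdeleRing (𝓞 F) F) := hvo.mem_nhds (h0v (mem_singleton 0))
  obtain ⟨𝔫, h𝔫, h𝔫v⟩ := FiniteAdeleRing.exists_forall_valued_le_idealRadius_imp_mem (K := F) hv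
  refine ⟨𝔫, h𝔫, fun δ' hδL k hk => ?_⟩
  have hmem : (k, δ') ∈ Θ ⁻¹' U := huv ⟨hKu' hk, h𝔫v δ' fun v => hδL v⟩
  exact hmem

omit [Algebra.IsQuadraticExtension F E] in
/-- **UNIFORM COMPACT SUPPORTS of the singular kernel with a compact conjugating variable.** For `f` of compact support, `K` compact and
the singular base point `γ₀ = ι(d(a,b,a))`, `a ≠ b`: there are compact `X_c ⊆ 𝔸_E` and `W_c ⊆ 𝔸_E⁻` with
`f(k⁻¹ (u(x)⁻¹ (γ₀ n(w)) u(x)) k) ≠ 0 ⇒ x ∈ X_c ∧ w ∈ W_c` for all `k ∈ K` (★ `hasCompactSupport_singularKernel` applied to the indicator of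
the compact `K · tsupport f · K⁻¹`). [cite: Rogawski1990, §7.2 (pp. 94–95)] -/
theorem exists_isCompact_singularKernel_conj_support (hc : c * c = 1) {a b : Eˣ} (hab : (a : E) ≠ (b : E))
    {g₀ : (quasiSplit F E c 3).Rational} {γ₀ : (quasiSplit F E c 3).arithmeticSubgroup}
    (hg₀ : ((g₀.val : GL (Fin 3) E) : Matrix (Fin 3) (Fin 3) E) = !![(a : E), 0, 0; 0, b, 0; 0, 0, a])
    (hγ₀ : (γ₀ : (quasiSplit F E c 3).Adelic) = (quasiSplit F E c 3).toAdelic g₀)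
    {KU : Set (quasiSplit F E c 3).Adelic} (hK : IsCompact KU) {f : (quasiSplit F E c 3).Adelic → ℂ} (hf : HasCompactSupport f) :
    ∃ X_c : Set (AdeleRing (𝓞 E) E), IsCompact X_c ∧ ∃ W_c : Set (traceZeroAdele F E c), IsCompact W_c ∧
      ∀ k ∈ KU, ∀ (x : AdeleRing (𝓞 E) E) (w : traceZeroAdele F E c),
        f (k⁻¹ * ((((heisElt hc x (0 : traceZeroAdele F E c) : unipotentInBorel F E c 3) : borelAdelic F E c 3) :
              (quasiSplit F E c 3).Adelic)⁻¹ *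
          ((γ₀ : (quasiSplit F E c 3).Adelic) *
            (((heisElt hc 0 w : unipotentInBorel F E c 3) : borelAdelic F E c 3) : (quasiSplit F E c 3).Adelic)) *
          (((heisElt hc x (0 : traceZeroAdele F E c) : unipotentInBorel F E c 3) : borelAdelic F E c 3) :
              (quasiSplit F E c 3).Adelic)) * k) ≠ 0 → x ∈ X_c ∧ w ∈ W_c := by
  -- the compact `S₀ = K · tsupport f · K⁻¹` and its indicator
  set S₀ : Set (quasiSplit F E c 3).Adelic :=
    (fun p : (quasiSplit F E c 3).Adelic × (quasiSplit F E c 3).Adelic => p.1 * p.2 * p.1⁻¹) '' (KU ×ˢ tsupport f) with hS₀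
  have hS₀c : IsCompact S₀ := (hK.prod hf.isCompact).image ((continuous_fst.mul continuous_snd).mul continuous_fst.inv)
  have hχ : HasCompactSupport (S₀.indicator fun _ => (1 : ℝ)) :=
    HasCompactSupport.intro hS₀c fun g hg => indicator_of_notMem hg _
  obtain hF := hasCompactSupport_singularKernel hc hab hg₀ hγ₀ hχ
  set C := tsupport fun p : AdeleRing (𝓞 E) E × traceZeroAdele F E c =>
      S₀.indicator (fun _ => (1 : ℝ)) ((((heisElt hc p.1 (0 : traceZeroAdele F E c) : unipotentInBorel F E c 3) : borelAdelic F E c 3) :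
            (quasiSplit F E c 3).Adelic)⁻¹ *
        ((γ₀ : (quasiSplit F E c 3).Adelic) *
          (((heisElt hc 0 p.2 : unipotentInBorel F E c 3) : borelAdelic F E c 3) : (quasiSplit F E c 3).Adelic)) *
        (((heisElt hc p.1 (0 : traceZeroAdele F E c) : unipotentInBorel F E c 3) : borelAdelic F E c 3) :
            (quasiSplit F E c 3).Adelic)) with hC
  have hCc : IsCompact C := hF
  refine ⟨Prod.fst '' C, hCc.image continuous_fst, Prod.snd '' C, hCc.image continuous_snd, fun k hk x w hne => ?_⟩
  -- the conjugated point lies in `S₀`, so `(x, w)` lies in the support of the indicator kernel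
  have hmemS₀ : ((((heisElt hc x (0 : traceZeroAdele F E c) : unipotentInBorel F E c 3) : borelAdelic F E c 3) :
            (quasiSplit F E c 3).Adelic)⁻¹ *
        ((γ₀ : (quasiSplit F E c 3).Adelic) *
          (((heisElt hc 0 w : unipotentInBorel F E c 3) : borelAdelic F E c 3) : (quasiSplit F E c 3).Adelic)) *
        (((heisElt hc x (0 : traceZeroAdele F E c) : unipotentInBorel F E c 3) : borelAdelic F E c 3) :
            (quasiSplit F E c 3).Adelic)) ∈ S₀ := by
    refine ⟨(k, k⁻¹ * ((((heisElt hc x (0 : traceZeroAdele F E c) : unipotentInBorel F E c 3) : borelAdelic F E c 3) :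
            (quasiSplit F E c 3).Adelic)⁻¹ *
        ((γ₀ : (quasiSplit F E c 3).Adelic) *
          (((heisElt hc 0 w : unipotentInBorel F E c 3) : borelAdelic F E c 3) : (quasiSplit F E c 3).Adelic)) *
        (((heisElt hc x (0 : traceZeroAdele F E c) : unipotentInBorel F E c 3) : borelAdelic F E c 3) :
            (quasiSplit F E c 3).Adelic)) * k), ⟨hk, subset_tsupport _ hne⟩, ?_⟩
    dsimp only
    group
  have hmemC : (x, w) ∈ C := by
    refine subset_tsupport _ ?_
    simp only [Function.mem_support, ne_eq]
    rw [indicator_of_mem hmemS₀]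
    exact one_ne_zero
  exact ⟨⟨(x, w), hmemC, rfl⟩, ⟨(x, w), hmemC, rfl⟩⟩

end Plumbing

/-! ## §2 Archimedean smoothness of the singular line function -/

section ArchSmooth

variable [Algebra.IsQuadraticExtension F E] {δ : E}
  [MeasurableSpace (AdeleRing (𝓞 E) E)] [BorelSpace (AdeleRing (𝓞 E) E)]
  {KU : Subgroup (quasiSplit F E c 3).Adelic} [MeasurableSpace KU] [BorelSpace KU]

/-- **ARCHIMEDEAN SMOOTHNESS OF THE SINGULAR LINE FUNCTION (smooth-kernel form).** Let `f = η ∘ π` for a smooth kernel `η` on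
`GL₃(𝔸_E)`, `K ≤ G(𝔸_F)` compact with a finite Borel measure `μK`, `μX` a Haar measure on `𝔸_E`, `γ₀ = ι(d(a,b,a))` with `a ≠ b`, and
`θ` the centre line. Then for every `y ∈ 𝔸_F^∞`, `t_∞ ↦ ∫_{𝔸_E} ∫_K f(k⁻¹ (u(x)⁻¹ (γ₀ n(θ(t_∞, y))) u(x)) k) dμK dμX` is `C^∞` on `F_∞`:
Fubini, then ★ `IsSmoothKernelGL.contDiff_integral_of_toMixed_eq` for the family whose archimedean part is
`π(k⁻¹)_∞ (π(u(x)⁻¹)_∞ (π(γ₀)_∞ (1 + (θ t)_∞ E₀₂)) π(u(x))_∞) π(k)_∞`, real-affine in `t_∞`.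
[cite: Rogawski1990, §7.2 (pp. 94–95)] [cite: HormanderALPDO1, Thm. 1.1.9] -/
theorem contDiff_singularLine_kAverage_of_isSmoothKernelGL (hc : c * c = 1) (hcδ : c δ = -δ) (hδ : δ ≠ 0) {a b : Eˣ}
    (hab : (a : E) ≠ (b : E)) {g₀ : (quasiSplit F E c 3).Rational} {γ₀ : (quasiSplit F E c 3).arithmeticSubgroup}
    (hg₀ : ((g₀.val : GL (Fin 3) E) : Matrix (Fin 3) (Fin 3) E) = !![(a : E), 0, 0; 0, b, 0; 0, 0, a])
    (hγ₀ : (γ₀ : (quasiSplit F E c 3).Adelic) = (quasiSplit F E c 3).toAdelic g₀)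
    (μX : Measure (AdeleRing (𝓞 E) E)) [μX.IsAddHaarMeasure] (hK : IsCompact (KU : Set (quasiSplit F E c 3).Adelic))
    (μK : Measure KU) [IsFiniteMeasure μK] {f : (quasiSplit F E c 3).Adelic → ℂ} {η : GL (Fin 3) (AdeleRing (𝓞 E) E) → ℂ}
    (hη : IsSmoothKernelGL 3 E η) (hfη : ∀ g, f g = η (adelicVal F E c 3 _ g)) (y : FiniteAdeleRing (𝓞 F) F) :
    ContDiff ℝ ∞ fun s : mixedSpace F =>
      ∫ x : AdeleRing (𝓞 E) E, (∫ k, f ((k : (quasiSplit F E c 3).Adelic)⁻¹ *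
        ((((heisElt hc x (0 : traceZeroAdele F E c) : unipotentInBorel F E c 3) : borelAdelic F E c 3) :
              (quasiSplit F E c 3).Adelic)⁻¹ *
          ((γ₀ : (quasiSplit F E c 3).Adelic) *
            (((heisElt hc 0 (traceZeroLine F E c hcδ hδ
                ((((InfiniteAdeleRing.ringEquiv_mixedSpace F).symm s, y) : AdeleRing (𝓞 F) F))) : unipotentInBorel F E c 3) :
                borelAdelic F E c 3) : (quasiSplit F E c 3).Adelic)) *
          (((heisElt hc x (0 : traceZeroAdele F E c) : unipotentInBorel F E c 3) : borelAdelic F E c 3) :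
              (quasiSplit F E c 3).Adelic)) * k) ∂μK) ∂μX := by
  haveI : T2Space (AdeleRing (𝓞 E) E) := t2Space_adeleRing E
  haveI : LocallyCompactSpace (AdeleRing (𝓞 E) E) := locallyCompactSpace_adeleRing' E
  haveI : SecondCountableTopology (AdeleRing (𝓞 E) E) := secondCountableTopology_adeleRing E
  haveI : SecondCountableTopology (GL (Fin 3) (AdeleRing (𝓞 E) E)) := secondCountableTopology_generalLinearGroup_adeleRing E (Fin 3)
  haveI : SecondCountableTopology (quasiSplit F E c 3).Adelic :=
    inferInstanceAs (SecondCountableTopology (adelic F E c 3 ((StdForm.antidiagonal 3).over E)))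
  haveI : SecondCountableTopology KU := TopologicalSpace.Subtype.secondCountableTopology _
  haveI : CompactSpace KU := isCompact_iff_compactSpace.1 hK
  -- abbreviations (all through the chart `heisChart`, definitionally equal to the `heisElt` letters)
  set uA : AdeleRing (𝓞 E) E → (quasiSplit F E c 3).Adelic := fun x =>
    (((heisElt hc x (0 : traceZeroAdele F E c) : unipotentInBorel F E c 3) : borelAdelic F E c 3) : (quasiSplit F E c 3).Adelic)
    with huA
  set nA : traceZeroAdele F E c → (quasiSplit F E c 3).Adelic := fun w =>
    (((heisElt hc 0 w : unipotentInBorel F E c 3) : borelAdelic F E c 3) : (quasiSplit F E c 3).Adelic) with hnA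
  have huA' : uA = fun x => ((heisChart hc (x, (0 : traceZeroAdele F E c)) : adelicUnipotent F E c 3) : (quasiSplit F E c 3).Adelic) :=
    funext fun x => (coe_heisChart hc (x, (0 : traceZeroAdele F E c))).symm
  have hnA' : nA = fun w => ((heisChart hc ((0 : AdeleRing (𝓞 E) E), w) : adelicUnipotent F E c 3) : (quasiSplit F E c 3).Adelic) :=
    funext fun w => (coe_heisChart hc ((0 : AdeleRing (𝓞 E) E), w)).symm
  have huAc : Continuous uA := by
    rw [huA']
    exact continuous_subtype_val.comp ((heisChart hc).continuous.comp (continuous_id.prodMk continuous_const))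
  have hnAc : Continuous nA := by
    rw [hnA']
    exact continuous_subtype_val.comp ((heisChart hc).continuous.comp (continuous_const.prodMk continuous_id))
  -- the family `G (x, k) s = π(k⁻¹ (u(x)⁻¹ (γ₀ n((traceZeroLine F E c hcδ hδ)(s, y))) u(x)) k)`
  set G : AdeleRing (𝓞 E) E × KU → mixedSpace F → GL (Fin 3) (AdeleRing (𝓞 E) E) := fun p s =>
    adelicVal F E c 3 _ (((p.2 : (quasiSplit F E c 3).Adelic))⁻¹ * ((uA p.1)⁻¹ * ((γ₀ : (quasiSplit F E c 3).Adelic) *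
      nA ((traceZeroLine F E c hcδ hδ) ((((InfiniteAdeleRing.ringEquiv_mixedSpace F).symm s, y) : AdeleRing (𝓞 F) F)))) * uA p.1) *
      (p.2 : (quasiSplit F E c 3).Adelic)) with hGdef
  have hsθ : Continuous fun s : mixedSpace F => (traceZeroLine F E c hcδ hδ) ((((InfiniteAdeleRing.ringEquiv_mixedSpace F).symm s, y) : AdeleRing (𝓞 F) F)) :=
    (traceZeroLine F E c hcδ hδ).continuous.comp ((continuous_ringEquiv_mixedSpace_symm F).prodMk continuous_const)
  have hk : Continuous fun q : (AdeleRing (𝓞 E) E × KU) × mixedSpace F => (q.1.2 : (quasiSplit F E c 3).Adelic) :=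
    continuous_subtype_val.comp (continuous_snd.comp continuous_fst)
  have hu : Continuous fun q : (AdeleRing (𝓞 E) E × KU) × mixedSpace F => uA q.1.1 := huAc.comp (continuous_fst.comp continuous_fst)
  have hnθ : Continuous fun q : (AdeleRing (𝓞 E) E × KU) × mixedSpace F =>
      nA (traceZeroLine F E c hcδ hδ ((((InfiniteAdeleRing.ringEquiv_mixedSpace F).symm q.2, y) : AdeleRing (𝓞 F) F))) :=
    hnAc.comp (hsθ.comp continuous_snd)
  have hGc : Continuous (Function.uncurry G) :=
    continuous_subtype_val.comp ((hk.inv.mul ((hu.inv.mul (continuous_const.mul hnθ)).mul hu)).mul hk)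
  -- the archimedean reading of the centre line is real-affine in `t_∞`
  set Ladd : mixedSpace F →+ mixedSpace E :=
    (archHom E).toAddMonoidHom.comp ((traceZeroAdele F E c).subtype.comp
      (((traceZeroLine F E c hcδ hδ : AdeleRing (𝓞 F) F →+ traceZeroAdele F E c)).comp
        ((AddMonoidHom.inl (InfiniteAdeleRing F) (FiniteAdeleRing (𝓞 F) F)).comp
          ((InfiniteAdeleRing.ringEquiv_mixedSpace F).symm : mixedSpace F →+ InfiniteAdeleRing F)))) with hLadd
  have hLapply : ∀ s : mixedSpace F, Ladd s = archHom E (((traceZeroLine F E c hcδ hδ)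
      ((((InfiniteAdeleRing.ringEquiv_mixedSpace F).symm s, (0 : FiniteAdeleRing (𝓞 F) F)) : AdeleRing (𝓞 F) F)) :
        traceZeroAdele F E c) : AdeleRing (𝓞 E) E) := fun s => rfl
  have hLc : Continuous Ladd := by
    have h : Continuous fun s : mixedSpace F => archHom E (((traceZeroLine F E c hcδ hδ)
        ((((InfiniteAdeleRing.ringEquiv_mixedSpace F).symm s, (0 : FiniteAdeleRing (𝓞 F) F)) : AdeleRing (𝓞 F) F)) :
          traceZeroAdele F E c) : AdeleRing (𝓞 E) E) :=
      ((continuous_ringEquiv_mixedSpace E).comp continuous_fst).comp (continuous_subtype_val.comp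
        ((traceZeroLine F E c hcδ hδ).continuous.comp ((continuous_ringEquiv_mixedSpace_symm F).prodMk continuous_const)))
    exact h.congr fun s => (hLapply s).symm
  set L : mixedSpace F →L[ℝ] mixedSpace E := Ladd.toRealLinearMap hLc with hLdef
  set wy : mixedSpace E := archHom E (((traceZeroLine F E c hcδ hδ) ((((0 : InfiniteAdeleRing F), y) : AdeleRing (𝓞 F) F)) : traceZeroAdele F E c) :
    AdeleRing (𝓞 E) E) with hwy
  have hθs : ∀ s : mixedSpace F, archHom E (((traceZeroLine F E c hcδ hδ)
      ((((InfiniteAdeleRing.ringEquiv_mixedSpace F).symm s, y) : AdeleRing (𝓞 F) F)) : traceZeroAdele F E c) : AdeleRing (𝓞 E) E) =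
        L s + wy := by
    intro s
    set a₁ : AdeleRing (𝓞 F) F := ((((InfiniteAdeleRing.ringEquiv_mixedSpace F).symm s, (0 : FiniteAdeleRing (𝓞 F) F)) :
      AdeleRing (𝓞 F) F)) with ha₁
    set a₂ : AdeleRing (𝓞 F) F := ((((0 : InfiniteAdeleRing F), y) : AdeleRing (𝓞 F) F)) with ha₂
    have hsplit : ((((InfiniteAdeleRing.ringEquiv_mixedSpace F).symm s, y) : AdeleRing (𝓞 F) F)) = a₁ + a₂ :=
      Prod.ext (add_zero _).symm (zero_add _).symm
    rw [hsplit, map_add, AddSubgroup.coe_add, map_add]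
    rfl
  -- the polynomial `M` and the parameters `α`
  set M : (Matrix (Fin 3) (Fin 3) (mixedSpace E) × (Matrix (Fin 3) (Fin 3) (mixedSpace E) × (Matrix (Fin 3) (Fin 3) (mixedSpace E) ×
      (Matrix (Fin 3) (Fin 3) (mixedSpace E) × Matrix (Fin 3) (Fin 3) (mixedSpace E))))) × mixedSpace F →
      Matrix (Fin 3) (Fin 3) (mixedSpace E) := fun q =>
    q.1.1 * (q.1.2.1 * (q.1.2.2.1 * (1 + Matrix.single 0 2 (L q.2 + wy))) * q.1.2.2.2.1) * q.1.2.2.2.2 with hMdef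
  have hsingle : ContDiff ℝ ∞ fun v : mixedSpace E => Matrix.single (0 : Fin 3) (2 : Fin 3) v := by
    set ℓ : mixedSpace E →ₗ[ℝ] Matrix (Fin 3) (Fin 3) (mixedSpace E) :=
      { toFun := fun v => Matrix.single 0 2 v
        map_add' := Matrix.single_add 0 2
        map_smul' := fun r v => (Matrix.smul_single r 0 2 v).symm } with hℓ
    exact ℓ.toContinuousLinearMap.contDiff
  have hMs : ContDiff ℝ ∞ M := by
    have hA : ContDiff ℝ ∞ fun q : (Matrix (Fin 3) (Fin 3) (mixedSpace E) × (Matrix (Fin 3) (Fin 3) (mixedSpace E) ×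
        (Matrix (Fin 3) (Fin 3) (mixedSpace E) × (Matrix (Fin 3) (Fin 3) (mixedSpace E) × Matrix (Fin 3) (Fin 3) (mixedSpace E))))) ×
        mixedSpace F => q.1.1 := contDiff_fst.comp contDiff_fst
    have hB₁ : ContDiff ℝ ∞ fun q : (Matrix (Fin 3) (Fin 3) (mixedSpace E) × (Matrix (Fin 3) (Fin 3) (mixedSpace E) ×
        (Matrix (Fin 3) (Fin 3) (mixedSpace E) × (Matrix (Fin 3) (Fin 3) (mixedSpace E) × Matrix (Fin 3) (Fin 3) (mixedSpace E))))) ×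
        mixedSpace F => q.1.2.1 := contDiff_fst.comp (contDiff_snd.comp contDiff_fst)
    have hB₂ : ContDiff ℝ ∞ fun q : (Matrix (Fin 3) (Fin 3) (mixedSpace E) × (Matrix (Fin 3) (Fin 3) (mixedSpace E) ×
        (Matrix (Fin 3) (Fin 3) (mixedSpace E) × (Matrix (Fin 3) (Fin 3) (mixedSpace E) × Matrix (Fin 3) (Fin 3) (mixedSpace E))))) ×
        mixedSpace F => q.1.2.2.1 := contDiff_fst.comp (contDiff_snd.comp (contDiff_snd.comp contDiff_fst))
    have hB₃ : ContDiff ℝ ∞ fun q : (Matrix (Fin 3) (Fin 3) (mixedSpace E) × (Matrix (Fin 3) (Fin 3) (mixedSpace E) ×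
        (Matrix (Fin 3) (Fin 3) (mixedSpace E) × (Matrix (Fin 3) (Fin 3) (mixedSpace E) × Matrix (Fin 3) (Fin 3) (mixedSpace E))))) ×
        mixedSpace F => q.1.2.2.2.1 := contDiff_fst.comp (contDiff_snd.comp (contDiff_snd.comp (contDiff_snd.comp contDiff_fst)))
    have hD : ContDiff ℝ ∞ fun q : (Matrix (Fin 3) (Fin 3) (mixedSpace E) × (Matrix (Fin 3) (Fin 3) (mixedSpace E) ×
        (Matrix (Fin 3) (Fin 3) (mixedSpace E) × (Matrix (Fin 3) (Fin 3) (mixedSpace E) × Matrix (Fin 3) (Fin 3) (mixedSpace E))))) ×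
        mixedSpace F => q.1.2.2.2.2 := contDiff_snd.comp (contDiff_snd.comp (contDiff_snd.comp (contDiff_snd.comp contDiff_fst)))
    have hN : ContDiff ℝ ∞ fun q : (Matrix (Fin 3) (Fin 3) (mixedSpace E) × (Matrix (Fin 3) (Fin 3) (mixedSpace E) ×
        (Matrix (Fin 3) (Fin 3) (mixedSpace E) × (Matrix (Fin 3) (Fin 3) (mixedSpace E) × Matrix (Fin 3) (Fin 3) (mixedSpace E))))) ×
        mixedSpace F => (1 : Matrix (Fin 3) (Fin 3) (mixedSpace E)) + Matrix.single 0 2 (L q.2 + wy) :=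
      contDiff_const.add (hsingle.comp ((L.contDiff.comp contDiff_snd).add contDiff_const))
    exact (hA.mul ((hB₁.mul (hB₂.mul hN)).mul hB₃)).mul hD
  set α : AdeleRing (𝓞 E) E × KU → Matrix (Fin 3) (Fin 3) (mixedSpace E) × (Matrix (Fin 3) (Fin 3) (mixedSpace E) ×
      (Matrix (Fin 3) (Fin 3) (mixedSpace E) × (Matrix (Fin 3) (Fin 3) (mixedSpace E) × Matrix (Fin 3) (Fin 3) (mixedSpace E)))) :=
    fun p =>
      (((GLn.toMixed 3 E (adelicVal F E c 3 _ ((p.2 : (quasiSplit F E c 3).Adelic))⁻¹) : GL (Fin 3) (mixedSpace E)) :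
          Matrix (Fin 3) (Fin 3) (mixedSpace E)),
        ((((GLn.toMixed 3 E (adelicVal F E c 3 _ (uA p.1)⁻¹)) : GL (Fin 3) (mixedSpace E)) : Matrix (Fin 3) (Fin 3) (mixedSpace E)),
          ((((GLn.toMixed 3 E (adelicVal F E c 3 _ (γ₀ : (quasiSplit F E c 3).Adelic))) : GL (Fin 3) (mixedSpace E)) :
              Matrix (Fin 3) (Fin 3) (mixedSpace E)),
            ((((GLn.toMixed 3 E (adelicVal F E c 3 _ (uA p.1))) : GL (Fin 3) (mixedSpace E)) : Matrix (Fin 3) (Fin 3) (mixedSpace E)),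
              (((GLn.toMixed 3 E (adelicVal F E c 3 _ (p.2 : (quasiSplit F E c 3).Adelic))) : GL (Fin 3) (mixedSpace E)) :
                Matrix (Fin 3) (Fin 3) (mixedSpace E))))))
    with hαdef
  have hαc : Continuous α := by
    have hT : Continuous fun g : (quasiSplit F E c 3).Adelic =>
        (((GLn.toMixed 3 E (adelicVal F E c 3 _ g)) : GL (Fin 3) (mixedSpace E)) : Matrix (Fin 3) (Fin 3) (mixedSpace E)) :=
      Units.continuous_val.comp ((GLn.continuous_toMixed 3 E).comp continuous_subtype_val)
    have hk : Continuous fun p : AdeleRing (𝓞 E) E × KU => (p.2 : (quasiSplit F E c 3).Adelic) :=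
      continuous_subtype_val.comp continuous_snd
    exact (hT.comp hk.inv).prodMk ((hT.comp (huAc.comp continuous_fst).inv).prodMk (continuous_const.prodMk
      ((hT.comp (huAc.comp continuous_fst)).prodMk (hT.comp hk))))
  have hn : ∀ w : traceZeroAdele F E c, ((GLn.toMixed 3 E (adelicVal F E c 3 _ (nA w)) : GL (Fin 3) (mixedSpace E)) :
      Matrix (Fin 3) (Fin 3) (mixedSpace E)) = 1 + Matrix.single 0 2 (archHom E (w : AdeleRing (𝓞 E) E)) := fun w =>
    coe_toMixed_adelicVal_heisChart_zero hc w
  have hGM : ∀ p s, ((GLn.toMixed 3 E (G p s) : GL (Fin 3) (mixedSpace E)) : Matrix (Fin 3) (Fin 3) (mixedSpace E)) = M (α p, s) := by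
    intro p s
    simp only [hGdef, hMdef, hαdef, map_mul, Units.val_mul, hn, hθs]
  -- the uniform compact supports
  have hfc : HasCompactSupport f := by
    have h : f = η ∘ adelicVal F E c 3 _ := funext hfη
    rw [h]
    have hcl : IsClosed ((adelic F E c 3 ((StdForm.antidiagonal 3).over E) : Subgroup (GL (Fin 3) (AdeleRing (𝓞 E) E))) :
        Set (GL (Fin 3) (AdeleRing (𝓞 E) E))) := isClosed_unitaryGroupOfForm_conjAdele F E c _
    exact hη.hasCompactSupport.comp_isClosedEmbedding hcl.isClosedEmbedding_subtypeVal
  obtain ⟨X_c, hX_c, W_c, hW_c, hXW⟩ := exists_isCompact_singularKernel_conj_support hc hab hg₀ hγ₀ hK hfc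
  set P_c : Set (mixedSpace F) := (fun t : AdeleRing (𝓞 F) F => archHom F t) '' ((traceZeroLine F E c hcδ hδ).symm '' W_c) with hP_c
  have hP_cc : IsCompact P_c :=
    (hW_c.image (traceZeroLine F E c hcδ hδ).symm.continuous).image ((continuous_ringEquiv_mixedSpace F).comp continuous_fst)
  have hsupp : ∀ (p : AdeleRing (𝓞 E) E × KU) (s : mixedSpace F), η (G p s) ≠ 0 → p ∈ X_c ×ˢ (univ : Set KU) ∧ s ∈ P_c := by
    intro p s hne
    have hne' : f ((p.2 : (quasiSplit F E c 3).Adelic)⁻¹ * ((uA p.1)⁻¹ * ((γ₀ : (quasiSplit F E c 3).Adelic) *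
        nA ((traceZeroLine F E c hcδ hδ) ((((InfiniteAdeleRing.ringEquiv_mixedSpace F).symm s, y) : AdeleRing (𝓞 F) F)))) * uA p.1) *
        (p.2 : (quasiSplit F E c 3).Adelic)) ≠ 0 := by
      rw [hfη]
      exact hne
    obtain ⟨hx, hw⟩ := hXW p.2 p.2.2 p.1 _ hne'
    refine ⟨⟨hx, mem_univ _⟩, ⟨((((InfiniteAdeleRing.ringEquiv_mixedSpace F).symm s, y) : AdeleRing (𝓞 F) F)),
      ⟨_, hw, (traceZeroLine F E c hcδ hδ).symm_apply_apply _⟩, ?_⟩⟩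
    show archHom F ((((InfiniteAdeleRing.ringEquiv_mixedSpace F).symm s, y) : AdeleRing (𝓞 F) F)) = s
    rw [archHom_apply]
    exact (InfiniteAdeleRing.ringEquiv_mixedSpace F).apply_symm_apply s
  have hA_c : IsCompact (X_c ×ˢ (univ : Set KU)) := hX_c.prod isCompact_univ
  have hA_cm : MeasurableSet (X_c ×ˢ (univ : Set KU)) := hX_c.isClosed.measurableSet.prod MeasurableSet.univ
  have hμA : (μX.prod μK) (X_c ×ˢ (univ : Set KU)) < ⊤ := by
    rw [Measure.prod_prod]
    exact ENNReal.mul_lt_top hX_c.measure_lt_top (measure_lt_top μK _)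
  -- Fubini
  have hint : ∀ s : mixedSpace F, Integrable (fun p : AdeleRing (𝓞 E) E × KU => η (G p s)) (μX.prod μK) := fun s =>
    (hη.continuous.comp (hGc.comp (continuous_id.prodMk continuous_const))).integrable_of_hasCompactSupport
      (HasCompactSupport.intro hA_c fun p hp => by
        by_contra hne
        exact hp (hsupp p s hne).1)
  have heq : (fun s : mixedSpace F => ∫ x : AdeleRing (𝓞 E) E, (∫ k, f ((k : (quasiSplit F E c 3).Adelic)⁻¹ *
        ((uA x)⁻¹ * ((γ₀ : (quasiSplit F E c 3).Adelic) *
          nA ((traceZeroLine F E c hcδ hδ) ((((InfiniteAdeleRing.ringEquiv_mixedSpace F).symm s, y) : AdeleRing (𝓞 F) F)))) * uA x) * k) ∂μK) ∂μX) =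
      fun s => ∫ p, η (G p s) ∂(μX.prod μK) := by
    funext s
    rw [integral_prod _ (hint s)]
    simp only [hGdef, hfη]
  show ContDiff ℝ ∞ fun s : mixedSpace F => ∫ x : AdeleRing (𝓞 E) E, (∫ k, f ((k : (quasiSplit F E c 3).Adelic)⁻¹ *
        ((uA x)⁻¹ * ((γ₀ : (quasiSplit F E c 3).Adelic) *
          nA ((traceZeroLine F E c hcδ hδ) ((((InfiniteAdeleRing.ringEquiv_mixedSpace F).symm s, y) : AdeleRing (𝓞 F) F)))) * uA x) * k) ∂μK) ∂μX
  rw [heq]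
  exact hη.contDiff_integral_of_toMixed_eq hGc hαc hMs hGM hA_c hA_cm hμA hP_cc hsupp

/-- **ARCHIMEDEAN SMOOTHNESS OF THE SINGULAR LINE FUNCTION** for a test function `f ∈ C_c^∞(U(J₃)(𝔸_F))` (★ `IsQuasiSplitTest`): for every
`y ∈ 𝔸_F^∞`, `t_∞ ↦ ∫_{𝔸_E} ∫_K f(k⁻¹ (u(x)⁻¹ (γ₀ n(θ(t_∞, y))) u(x)) k) dμK dμX` is `C^∞` on `F_∞`.
[cite: Rogawski1990, §7.2 (pp. 94–95)] [cite: HormanderALPDO1, Thm. 1.1.9] -/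
theorem contDiff_singularLine_kAverage (hc : c * c = 1) (hcδ : c δ = -δ) (hδ : δ ≠ 0) {a b : Eˣ} (hab : (a : E) ≠ (b : E))
    {g₀ : (quasiSplit F E c 3).Rational} {γ₀ : (quasiSplit F E c 3).arithmeticSubgroup}
    (hg₀ : ((g₀.val : GL (Fin 3) E) : Matrix (Fin 3) (Fin 3) E) = !![(a : E), 0, 0; 0, b, 0; 0, 0, a])
    (hγ₀ : (γ₀ : (quasiSplit F E c 3).Adelic) = (quasiSplit F E c 3).toAdelic g₀)
    (μX : Measure (AdeleRing (𝓞 E) E)) [μX.IsAddHaarMeasure] (hK : IsCompact (KU : Set (quasiSplit F E c 3).Adelic))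
    (μK : Measure KU) [IsFiniteMeasure μK] {f : (quasiSplit F E c 3).Adelic → ℂ} (hf : IsQuasiSplitTest F E c 3 f)
    (y : FiniteAdeleRing (𝓞 F) F) :
    ContDiff ℝ ∞ fun s : mixedSpace F =>
      ∫ x : AdeleRing (𝓞 E) E, (∫ k, f ((k : (quasiSplit F E c 3).Adelic)⁻¹ *
        ((((heisElt hc x (0 : traceZeroAdele F E c) : unipotentInBorel F E c 3) : borelAdelic F E c 3) :
              (quasiSplit F E c 3).Adelic)⁻¹ *
          ((γ₀ : (quasiSplit F E c 3).Adelic) *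
            (((heisElt hc 0 (traceZeroLine F E c hcδ hδ
                ((((InfiniteAdeleRing.ringEquiv_mixedSpace F).symm s, y) : AdeleRing (𝓞 F) F))) : unipotentInBorel F E c 3) :
                borelAdelic F E c 3) : (quasiSplit F E c 3).Adelic)) *
          (((heisElt hc x (0 : traceZeroAdele F E c) : unipotentInBorel F E c 3) : borelAdelic F E c 3) :
              (quasiSplit F E c 3).Adelic)) * k) ∂μK) ∂μX := by
  obtain ⟨η₁, η₂, hη₁, hη₂, hfη⟩ := hf
  exact contDiff_singularLine_kAverage_of_isSmoothKernelGL hc hcδ hδ hab hg₀ hγ₀ μX hK μK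
    (isSmoothKernelGL_of_isTestFunctionGL_pair hη₁ hη₂) hfη y

end ArchSmooth

end UnitaryGroup

end Literature.NumberTheory.Automorphic
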